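import Summits.CriticalPhenomena.PercolationContinuityZ3.Theorems.PercNearOneGluingNoHeavyLowerTailKnQuestion8CoefficientwiseRootSetKernelRowTwoPrep
import HarnessLib

/-!
# The root-set kernel, row 2 of RCSET with `y` hanging off `q` (no `U–y` edge) — the combinatorial core — prim-lf-2 gen 60

Support file (`--supports stmt-CriticalPhenomena-4575`, closed), prover `prim-lf-2` (gen 60).  No definitions, no named facts, no sorries; standard axioms.
Memo `prim-lf-2/CW-ATOM-gen60.md` §5; companions `…RootSetKernelRowTwoCore.lean` (`q ∼ y`, `U ∼ y`), `…RootSetKernelRowTwoCoreNonAdj.lean` (`q ≁ y`), `…RootSetKernelRowTwoPrep.lean`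
(`split_box_bound`, `skew_box_bound`, `sum_powerset_union_of_disjoint`).

THE CORE (no `U–y` edges; `y` hangs off `q` by the nonempty bundle `Cq`, `q` hangs off `U` by the nonempty bundle `Aq`).  `V = U ⊔ {q,y}`; monotone `f, g`; maps
`R, P, B : Finset ι → Set V` (red cluster of `S`, red / blue cluster of `U`, as functions of the red outer edges `ω ⊆ Aq ∪ Cq`) with the axioms read off from connectivity:
`U ⊆ P ω, B ω`; `q ∈ P ω` iff some `Aq` edge is red, `q ∈ B ω` iff some `Aq` edge is blue; `y ∈ P ω` iff some `Aq` edge AND some `Cq` edge are red, `y ∈ B ω` iff some `Aq` edge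
and some `Cq` edge are blue; `R` monotone, `R ∅ ⊆ U`, `y ∉ R α` for `α ⊆ Aq`, and the PENDANT axioms `q ∉ R α → R(α ∪ γ) = R α`, `q ∈ R α → γ ≠ ∅ → R(α ∪ γ) = R α + y`.
* `Coefficientwise.rcset_row_two_core_noBy` — under these axioms `0 ≤ Σ_{ω ⊆ Aq ∪ Cq} [2·adm_S(ω) T(Rω,Bω) − adm_U(ω) T(Pω,Bω)]`.
Proof (memo §5): write `ω = α ∪ γ`.  A MIXED `α` has `adm_U` only at `γ ∈ {∅, Cq}` with `T_U = T(U+q, V)` both times, paid by `T(R α, V) + T(R α (+y), U+q)` (`skew_box_bound`);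
the mixed `γ` give `T_S ≥ 0`.  The POOLED pair `α ∈ {∅, Aq}`: at `γ ∈ {∅, Cq}` the four terms are `2[T(C,V) + T(A+y,U) − T(U,V)] + 2[T(C,U+q) + T(A,U) − T(U+q,U)] ≥ 0`
(`C = R ∅ ⊆ A = R Aq`; two `split_box_bound`), and every mixed `γ` gives `2[T(C,V) + T(A+y,U) − T(U,V)] ≥ 0` (when `q ∉ A` read `A` for `A+y`).
[cite: KozmaNitzan2024, Questions 8–9 (§5.5 p. 36) (context: the Question-8 pocket covariance programme)]
-/

namespace Summit.CriticalPhenomena.PercolationContinuityZ3.Theorems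

open Finset Literature.Probability.Percolation

namespace Coefficientwise

variable {ι V : Type*}

open Classical in
/-- **Row 2 of RCSET with no `U–y` edge — combinatorial core** (see the module docstring for the axioms on `R, P, B`). [cite: KozmaNitzan2024, Questions 8–9 (§5.5 p. 36) (context)] -/
theorem rcset_row_two_core_noBy [DecidableEq ι] (Aq Cq : Finset ι) (hAqCq : Disjoint Aq Cq) (hAqne : Aq.Nonempty) (hCqne : Cq.Nonempty)
    (U : Finset V) (y q : V) (hyq : y ≠ q) (hyU : y ∉ U) (hqU : q ∉ U) (hUc : ∀ v : V, v ≠ q → v ≠ y → v ∈ U)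
    (f g : Set V → ℝ) (hf : Monotone f) (hg : Monotone g) (R P B : Finset ι → Set V)
    (hUP : ∀ ω, (↑U : Set V) ⊆ P ω) (hUB : ∀ ω, (↑U : Set V) ⊆ B ω) (hRmono : ∀ ω ω' : Finset ι, ω ⊆ ω' → R ω ⊆ R ω') (hR0 : R ∅ ⊆ ↑U)
    (hqP : ∀ ω : Finset ι, q ∈ P ω ↔ ∃ i ∈ Aq, i ∈ ω) (hqB : ∀ ω : Finset ι, q ∈ B ω ↔ ∃ i ∈ Aq, i ∉ ω)
    (hyP : ∀ ω : Finset ι, y ∈ P ω ↔ (∃ i ∈ Aq, i ∈ ω) ∧ (∃ k ∈ Cq, k ∈ ω))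
    (hyB : ∀ ω : Finset ι, y ∈ B ω ↔ (∃ i ∈ Aq, i ∉ ω) ∧ (∃ k ∈ Cq, k ∉ ω))
    (hyA : ∀ α : Finset ι, α ⊆ Aq → y ∉ R α)
    (hpend0 : ∀ α γ : Finset ι, α ⊆ Aq → γ ⊆ Cq → q ∉ R α → R (α ∪ γ) = R α)
    (hpend1 : ∀ α γ : Finset ι, α ⊆ Aq → γ ⊆ Cq → q ∈ R α → γ ≠ ∅ → R (α ∪ γ) = insert y (R α)) :
    0 ≤ ∑ ω ∈ (Aq ∪ Cq).powerset, (2 * (if ¬ (y ∈ R ω ∧ y ∈ B ω) then (f (R ω) - f (B ω)) * (g (R ω) - g (B ω)) else 0) -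
      (if ¬ (y ∈ P ω ∧ y ∈ B ω) then (f (P ω) - f (B ω)) * (g (P ω) - g (B ω)) else 0)) := by
  -- notation
  set TS : Finset ι → ℝ := fun ω => (f (R ω) - f (B ω)) * (g (R ω) - g (B ω)) with hTS
  set TU : Finset ι → ℝ := fun ω => (f (P ω) - f (B ω)) * (g (P ω) - g (B ω)) with hTU
  set G : Finset ι → ℝ := fun ω => 2 * (if ¬ (y ∈ R ω ∧ y ∈ B ω) then TS ω else 0) - (if ¬ (y ∈ P ω ∧ y ∈ B ω) then TU ω else 0) with hG
  change 0 ≤ ∑ ω ∈ (Aq ∪ Cq).powerset, G ω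
  rw [sum_powerset_union_of_disjoint Aq Cq hAqCq G]
  /- the four vertex patterns of a set containing `U` -/
  set SU : Set V := {v | v ∈ (↑U : Set V) ∨ (v = q ∧ false = true) ∨ (v = y ∧ false = true)} with hSU
  set SUq : Set V := {v | v ∈ (↑U : Set V) ∨ (v = q ∧ true = true) ∨ (v = y ∧ false = true)} with hSUq
  set SV : Set V := {v | v ∈ (↑U : Set V) ∨ (v = q ∧ true = true) ∨ (v = y ∧ true = true)} with hSV
  have set_eq : ∀ X : Set V, (↑U : Set V) ⊆ X → ∀ (bq bY : Bool), (q ∈ X ↔ bq = true) → (y ∈ X ↔ bY = true) →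
      X = {v | v ∈ (↑U : Set V) ∨ (v = q ∧ bq = true) ∨ (v = y ∧ bY = true)} := by
    intro X hUX bq bY hq hy
    ext v
    simp only [Set.mem_setOf_eq]
    constructor
    · intro hv
      by_cases h1 : v = q
      · subst h1; exact Or.inr (Or.inl ⟨rfl, hq.mp hv⟩)
      by_cases h2 : v = y
      · subst h2; exact Or.inr (Or.inr ⟨rfl, hy.mp hv⟩)
      exact Or.inl (Finset.mem_coe.mpr (hUc v h1 h2))
    · rintro (hv | ⟨rfl, h⟩ | ⟨rfl, h⟩)
      · exact hUX hv
      · exact hq.mpr h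
      · exact hy.mpr h
  have hU_SU : (↑U : Set V) ⊆ SU := fun v hv => Or.inl hv
  have hSU_SUq : SU ⊆ SUq := by intro v hv; simp only [hSU, hSUq, Set.mem_setOf_eq] at hv ⊢; tauto
  have hSUq_SV : SUq ⊆ SV := by intro v hv; simp only [hSUq, hSV, Set.mem_setOf_eq] at hv ⊢; tauto
  have hSV_univ : ∀ X : Set V, X ⊆ SV := by
    intro X v _
    by_cases h1 : v = q
    · exact Or.inr (Or.inl ⟨h1, rfl⟩)
    by_cases h2 : v = y
    · exact Or.inr (Or.inr ⟨h2, rfl⟩)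
    exact Or.inl (Finset.mem_coe.mpr (hUc v h1 h2))
  have sub_SUq_of : ∀ X : Set V, y ∉ X → X ⊆ SUq := by
    intro X hyX v hv
    by_cases h1 : v = q
    · exact Or.inr (Or.inl ⟨h1, rfl⟩)
    have h2 : v ≠ y := fun h => hyX (h ▸ hv)
    exact Or.inl (Finset.mem_coe.mpr (hUc v h1 h2))
  have sub_SU_of : ∀ X : Set V, q ∉ X → y ∉ X → X ⊆ SU := by
    intro X hqX hyX v hv
    have h1 : v ≠ q := fun h => hqX (h ▸ hv)
    have h2 : v ≠ y := fun h => hyX (h ▸ hv)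
    exact Or.inl (Finset.mem_coe.mpr (hUc v h1 h2))
  have hySU : y ∉ SU := by intro h; rcases h with h | ⟨_, h⟩ | ⟨_, h⟩ <;> first | exact hyU (Finset.mem_coe.mp h) | exact Bool.false_ne_true h
  have hySUq : y ∉ SUq := by
    intro h; rcases h with h | ⟨h1, _⟩ | ⟨_, h⟩
    · exact hyU (Finset.mem_coe.mp h)
    · exact hyq h1
    · exact Bool.false_ne_true h
  have hyV : y ∈ SV := Or.inr (Or.inr ⟨rfl, rfl⟩)
  have tt : ∀ {p : Prop}, p → (p ↔ true = true) := fun h => ⟨fun _ => rfl, fun _ => h⟩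
  have ff : ∀ {p : Prop}, ¬ p → (p ↔ false = true) := fun h => ⟨fun hp => absurd hp h, fun h' => absurd h' Bool.false_ne_true⟩
  /- membership bookkeeping for `ω = α ∪ γ` -/
  obtain ⟨i₀, hi₀⟩ := hAqne
  obtain ⟨k₀, hk₀⟩ := hCqne
  have hAq_ne : Aq ≠ ∅ := Finset.nonempty_iff_ne_empty.mp ⟨i₀, hi₀⟩
  have hCq_ne : Cq ≠ ∅ := Finset.nonempty_iff_ne_empty.mp ⟨k₀, hk₀⟩
  have hAC' : ∀ i, i ∈ Aq → i ∉ Cq := fun i hi hk => Finset.disjoint_left.mp hAqCq hi hk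
  have exA : ∀ α γ : Finset ι, α ⊆ Aq → γ ⊆ Cq → ((∃ i ∈ Aq, i ∈ α ∪ γ) ↔ α.Nonempty) := by
    intro α γ hα hγ
    constructor
    · rintro ⟨i, hi, hiu⟩
      rcases Finset.mem_union.mp hiu with h | h
      · exact ⟨i, h⟩
      · exact absurd (hγ h) (hAC' i hi)
    · rintro ⟨i, hi⟩; exact ⟨i, hα hi, Finset.mem_union_left _ hi⟩
  have exC : ∀ α γ : Finset ι, α ⊆ Aq → γ ⊆ Cq → ((∃ k ∈ Cq, k ∈ α ∪ γ) ↔ γ.Nonempty) := by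
    intro α γ hα hγ
    constructor
    · rintro ⟨k, hk, hku⟩
      rcases Finset.mem_union.mp hku with h | h
      · exact absurd hk (hAC' k (hα h))
      · exact ⟨k, h⟩
    · rintro ⟨k, hk⟩; exact ⟨k, hγ hk, Finset.mem_union_right _ hk⟩
  have nexA : ∀ α γ : Finset ι, α ⊆ Aq → γ ⊆ Cq → ((∃ i ∈ Aq, i ∉ α ∪ γ) ↔ α ≠ Aq) := by
    intro α γ hα hγ
    constructor
    · rintro ⟨i, hi, hiu⟩ h; subst h; exact hiu (Finset.mem_union_left _ hi)
    · intro hne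
      obtain ⟨i, hi, hia⟩ := Finset.not_subset.mp (fun h => hne (Finset.Subset.antisymm hα h))
      exact ⟨i, hi, fun hu => (Finset.mem_union.mp hu).elim hia (fun h => hAC' i hi (hγ h))⟩
  have nexC : ∀ α γ : Finset ι, α ⊆ Aq → γ ⊆ Cq → ((∃ k ∈ Cq, k ∉ α ∪ γ) ↔ γ ≠ Cq) := by
    intro α γ hα hγ
    constructor
    · rintro ⟨k, hk, hku⟩ h; subst h; exact hku (Finset.mem_union_right _ hk)
    · intro hne
      obtain ⟨k, hk, hkc⟩ := Finset.not_subset.mp (fun h => hne (Finset.Subset.antisymm hγ h))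
      exact ⟨k, hk, fun hu => (Finset.mem_union.mp hu).elim (fun h => hAC' k (hα h) hk) hkc⟩
  -- values of `P` and `B` as one of `SU, SUq, SV`
  have P_is : ∀ α γ : Finset ι, α ⊆ Aq → γ ⊆ Cq → ∀ bq bY : Bool, (α.Nonempty ↔ bq = true) → (α.Nonempty ∧ γ.Nonempty ↔ bY = true) →
      P (α ∪ γ) = {v | v ∈ (↑U : Set V) ∨ (v = q ∧ bq = true) ∨ (v = y ∧ bY = true)} := by
    intro α γ hα hγ bq bY h1 h2
    refine set_eq _ (hUP _) bq bY ?_ ?_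
    · rw [hqP, exA α γ hα hγ]; exact h1
    · rw [hyP, exA α γ hα hγ, exC α γ hα hγ]; exact h2
  have B_is : ∀ α γ : Finset ι, α ⊆ Aq → γ ⊆ Cq → ∀ bq bY : Bool, (α ≠ Aq ↔ bq = true) → (α ≠ Aq ∧ γ ≠ Cq ↔ bY = true) →
      B (α ∪ γ) = {v | v ∈ (↑U : Set V) ∨ (v = q ∧ bq = true) ∨ (v = y ∧ bY = true)} := by
    intro α γ hα hγ bq bY h1 h2
    refine set_eq _ (hUB _) bq bY ?_ ?_
    · rw [hqB, nexA α γ hα hγ]; exact h1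
    · rw [hyB, nexA α γ hα hγ, nexC α γ hα hγ]; exact h2
  -- the basic sets of `R`
  set C : Set V := R ∅ with hC
  set A : Set V := R Aq with hA
  have hCU : C ⊆ SU := hR0.trans hU_SU
  have hCA : C ⊆ A := hRmono _ _ (Finset.empty_subset _)
  have hAUq : A ⊆ SUq := sub_SUq_of A (hyA Aq subset_rfl)
  have hqC : q ∉ C := fun h => hqU (Finset.mem_coe.mp (hR0 h))
  /- split the `α`-sum: `∅`, `Aq`, mixed; and the inner `γ`-sums: `∅`, `Cq`, mixed -/
  set F : Finset ι → ℝ := fun α => ∑ γ ∈ Cq.powerset, G (α ∪ γ) with hF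
  change 0 ≤ ∑ α ∈ Aq.powerset, F α
  have h0A : (∅ : Finset ι) ∈ Aq.powerset := Finset.mem_powerset.mpr (Finset.empty_subset _)
  have hAA : Aq ∈ Aq.powerset.erase ∅ := Finset.mem_erase.mpr ⟨hAq_ne, Finset.mem_powerset.mpr subset_rfl⟩
  rw [← Finset.add_sum_erase _ _ h0A, ← Finset.add_sum_erase _ _ hAA, ← add_assoc]
  have h0C : (∅ : Finset ι) ∈ Cq.powerset := Finset.mem_powerset.mpr (Finset.empty_subset _)
  have hCC : Cq ∈ Cq.powerset.erase ∅ := Finset.mem_erase.mpr ⟨hCq_ne, Finset.mem_powerset.mpr subset_rfl⟩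
  have splitC : ∀ φ : Finset ι → ℝ, ∑ γ ∈ Cq.powerset, φ γ = φ ∅ + φ Cq + ∑ γ ∈ (Cq.powerset.erase ∅).erase Cq, φ γ := by
    intro φ; rw [← Finset.add_sum_erase _ _ h0C, ← Finset.add_sum_erase _ _ hCC, ← add_assoc]
  have memC3 : ∀ γ, γ ∈ (Cq.powerset.erase ∅).erase Cq → γ ⊆ Cq ∧ γ ≠ ∅ ∧ γ ≠ Cq := by
    intro γ hγ
    obtain ⟨h1, h2⟩ := Finset.mem_erase.mp hγ
    obtain ⟨h3, h4⟩ := Finset.mem_erase.mp h2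
    exact ⟨Finset.mem_powerset.mp h4, h3, h1⟩
  -- on a colouring where `U` is inadmissible and `S` is admissible with `R ⊆ B`, the summand is `≥ 0`; we package the two frequent shapes
  have G_of_admS_only : ∀ ω, (y ∈ P ω ∧ y ∈ B ω) → G ω = 2 * (if ¬ (y ∈ R ω ∧ y ∈ B ω) then TS ω else 0) := by
    intro ω h; simp only [hG, if_neg (not_not.mpr h), sub_zero]
  have G_of_both : ∀ ω, ¬ (y ∈ R ω ∧ y ∈ B ω) → ¬ (y ∈ P ω ∧ y ∈ B ω) → G ω = 2 * TS ω - TU ω := by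
    intro ω h1 h2; simp only [hG, if_pos h1, if_pos h2]
  have TS_nonneg_of_sub : ∀ ω, R ω ⊆ B ω → 0 ≤ (if ¬ (y ∈ R ω ∧ y ∈ B ω) then TS ω else 0) := by
    intro ω h
    by_cases hc : y ∈ R ω ∧ y ∈ B ω
    · rw [if_neg (not_not.mpr hc)]
    · rw [if_pos hc]; exact mul_nonneg_of_nonpos_of_nonpos (sub_nonpos.mpr (hf h)) (sub_nonpos.mpr (hg h))
  refine add_nonneg ?_ (Finset.sum_nonneg fun α hα => ?_)
  · /- the pooled pair `α ∈ {∅, Aq}` -/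
    have hsum : F ∅ + F Aq = ∑ γ ∈ Cq.powerset, (G (∅ ∪ γ) + G (Aq ∪ γ)) := by
      simp only [hF, ← Finset.sum_add_distrib]
    rw [hsum, splitC]
    -- `P`, `B` at the relevant colourings
    have P0 : ∀ γ, γ ⊆ Cq → P (∅ ∪ γ) = SU := fun γ hγ =>
      P_is ∅ γ (Finset.empty_subset _) hγ false false (ff Finset.not_nonempty_empty) (ff fun h => Finset.not_nonempty_empty h.1)
    have B0V : ∀ γ, γ ⊆ Cq → γ ≠ Cq → B (∅ ∪ γ) = SV := fun γ hγ hne =>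
      B_is ∅ γ (Finset.empty_subset _) hγ true true (tt fun h => hAq_ne h.symm) (tt ⟨fun h => hAq_ne h.symm, hne⟩)
    have B0C : B (∅ ∪ Cq) = SUq :=
      B_is ∅ Cq (Finset.empty_subset _) subset_rfl true false (tt fun h => hAq_ne h.symm) (ff fun h => h.2 rfl)
    have BA : ∀ γ, γ ⊆ Cq → B (Aq ∪ γ) = SU := fun γ hγ =>
      B_is Aq γ subset_rfl hγ false false (ff fun h => h rfl) (ff fun h => h.1 rfl)
    have PA0 : P (Aq ∪ ∅) = SUq :=
      P_is Aq ∅ subset_rfl (Finset.empty_subset _) true false (tt ⟨i₀, hi₀⟩) (ff fun h => Finset.not_nonempty_empty h.2)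
    have PAV : ∀ γ, γ ⊆ Cq → γ ≠ ∅ → P (Aq ∪ γ) = SV := fun γ hγ hne =>
      P_is Aq γ subset_rfl hγ true true (tt ⟨i₀, hi₀⟩) (tt ⟨⟨i₀, hi₀⟩, Finset.nonempty_of_ne_empty hne⟩)
    have R0 : ∀ γ, γ ⊆ Cq → R (∅ ∪ γ) = C := fun γ hγ => hpend0 ∅ γ (Finset.empty_subset _) hγ hqC
    -- every summand of the pair is `2 TS − TU` (both admissible): `y ∉ B(Aq ∪ γ) = SU`, `y ∉ P(∅ ∪ γ) = SU`, `y ∉ R(∅ ∪ γ) = C`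
    have G0 : ∀ γ, γ ⊆ Cq → G (∅ ∪ γ) = 2 * TS (∅ ∪ γ) - TU (∅ ∪ γ) := by
      intro γ hγ
      refine G_of_both _ (fun h => ?_) (fun h => ?_)
      · rw [R0 γ hγ] at h; exact hySU (hCU h.1)
      · rw [P0 γ hγ] at h; exact hySU h.1
    have GA : ∀ γ, γ ⊆ Cq → G (Aq ∪ γ) = 2 * TS (Aq ∪ γ) - TU (Aq ∪ γ) := by
      intro γ hγ
      refine G_of_both _ (fun h => ?_) (fun h => ?_)
      · rw [BA γ hγ] at h; exact hySU h.2
      · rw [BA γ hγ] at h; exact hySU h.2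
    -- the red cluster of `S` on `Aq ∪ γ`: `A` or `A + y`
    have RA_cases : ∀ γ, γ ⊆ Cq → γ ≠ ∅ → (R (Aq ∪ γ) = A ∧ A ⊆ SU) ∨ R (Aq ∪ γ) = insert y A := by
      intro γ hγ hne
      by_cases hqA : q ∈ A
      · exact Or.inr (hpend1 Aq γ subset_rfl hγ hqA hne)
      · exact Or.inl ⟨hpend0 Aq γ subset_rfl hγ hqA, sub_SU_of A hqA (hyA Aq subset_rfl)⟩
    have RA0 : R (Aq ∪ ∅) = A := by rw [Finset.union_empty]
    -- the two `split_box_bound` brackets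
    have hyA' : insert y A ⊆ SV := hSV_univ _
    have hCAy : C ⊆ insert y A := hCA.trans (Set.subset_insert _ _)
    have bracket1 : 0 ≤ (f C - f SV) * (g C - g SV) + (f (insert y A) - f SU) * (g (insert y A) - g SU) - (f SU - f SV) * (g SU - g SV) := by
      have hLS := split_box_bound (fc := f C) (fI := f SU) (fA := f (insert y A)) (fV := f SV) (gc := g C) (gI := g SU) (gA := g (insert y A)) (gV := g SV)
        (hf hCU) (hf hyA') (hg hCU) (hg hyA')
      nlinarith [hLS, mul_nonneg (sub_nonneg.mpr (hf hCAy)) (sub_nonneg.mpr (hg hCAy))]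
    have bracket1' : A ⊆ SU → 0 ≤ (f C - f SV) * (g C - g SV) + (f A - f SU) * (g A - g SU) - (f SU - f SV) * (g SU - g SV) := by
      intro hAU
      nlinarith [mul_nonneg (sub_nonneg.mpr (hf hAU)) (sub_nonneg.mpr (hg hAU)), mul_nonneg (sub_nonneg.mpr (hf hCU)) (sub_nonneg.mpr (hg hSUq_SV)),
        mul_nonneg (sub_nonneg.mpr (hg hCU)) (sub_nonneg.mpr (hf hSUq_SV)), mul_nonneg (sub_nonneg.mpr (hf hCU)) (sub_nonneg.mpr (hg hCU)),
        mul_nonneg (sub_nonneg.mpr (hf (hSU_SUq.trans hSUq_SV))) (sub_nonneg.mpr (hg hCU)),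
        mul_nonneg (sub_nonneg.mpr (hg (hSU_SUq.trans hSUq_SV))) (sub_nonneg.mpr (hf hCU))]
    have bracket2 : 0 ≤ (f C - f SUq) * (g C - g SUq) + (f A - f SU) * (g A - g SU) - (f SUq - f SU) * (g SUq - g SU) := by
      have hLS := split_box_bound (fc := f C) (fI := f SU) (fA := f A) (fV := f SUq) (gc := g C) (gI := g SU) (gA := g A) (gV := g SUq)
        (hf hCU) (hf hAUq) (hg hCU) (hg hAUq)
      nlinarith [hLS, mul_nonneg (sub_nonneg.mpr (hf hCA)) (sub_nonneg.mpr (hg hCA))]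
    refine add_nonneg ?_ (Finset.sum_nonneg fun γ hγ => ?_)
    · -- `γ = ∅` and `γ = Cq` together
      rw [G0 ∅ (Finset.empty_subset _), GA ∅ (Finset.empty_subset _), G0 Cq subset_rfl, GA Cq subset_rfl]
      simp only [hTS, hTU, P0 ∅ (Finset.empty_subset _), P0 Cq subset_rfl, B0V ∅ (Finset.empty_subset _) (fun h => hCq_ne h.symm), B0C,
        BA ∅ (Finset.empty_subset _), BA Cq subset_rfl, PA0, PAV Cq subset_rfl hCq_ne, R0 ∅ (Finset.empty_subset _), R0 Cq subset_rfl, RA0]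
      rcases RA_cases Cq subset_rfl hCq_ne with ⟨hR, hAU⟩ | hR
      · rw [hR]; nlinarith [bracket1' hAU, bracket2]
      · rw [hR]; nlinarith [bracket1, bracket2]
    · -- a mixed `γ`
      obtain ⟨hγC, hγ0, hγ1⟩ := memC3 γ hγ
      rw [G0 γ hγC, GA γ hγC]
      simp only [hTS, hTU, P0 γ hγC, B0V γ hγC hγ1, BA γ hγC, PAV γ hγC hγ0, R0 γ hγC]
      rcases RA_cases γ hγC hγ0 with ⟨hR, hAU⟩ | hR
      · rw [hR]; nlinarith [bracket1' hAU]
      · rw [hR]; nlinarith [bracket1]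
  · /- a mixed `α` -/
    obtain ⟨hα1, hα2⟩ := Finset.mem_erase.mp hα
    obtain ⟨hα0, hα3⟩ := Finset.mem_erase.mp hα2
    have hαAq : α ⊆ Aq := Finset.mem_powerset.mp hα3
    have hαne : α.Nonempty := Finset.nonempty_of_ne_empty hα0
    simp only [hF]
    rw [splitC]
    set Cα : Set V := R α with hCα
    have hCαUq : Cα ⊆ SUq := sub_SUq_of Cα (hyA α hαAq)
    -- `P`, `B` on the class
    have Pα0 : P (α ∪ ∅) = SUq := P_is α ∅ hαAq (Finset.empty_subset _) true false (tt hαne) (ff fun h => Finset.not_nonempty_empty h.2)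
    have PαV : ∀ γ, γ ⊆ Cq → γ ≠ ∅ → P (α ∪ γ) = SV := fun γ hγ hne =>
      P_is α γ hαAq hγ true true (tt hαne) (tt ⟨hαne, Finset.nonempty_of_ne_empty hne⟩)
    have BαV : ∀ γ, γ ⊆ Cq → γ ≠ Cq → B (α ∪ γ) = SV := fun γ hγ hne => B_is α γ hαAq hγ true true (tt hα1) (tt ⟨hα1, hne⟩)
    have BαC : B (α ∪ Cq) = SUq := B_is α Cq hαAq subset_rfl true false (tt hα1) (ff fun h => h.2 rfl)
    -- `γ = ∅`, `γ = Cq`: both admissible for `U` with `TU = T(SUq, SV)`; mixed `γ`: `U` inadmissible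
    have Gα0 : G (α ∪ ∅) = 2 * TS (α ∪ ∅) - TU (α ∪ ∅) := by
      refine G_of_both _ (fun h => ?_) (fun h => ?_)
      · rw [Finset.union_empty] at h; exact hyA α hαAq h.1
      · rw [Pα0] at h; exact hySUq h.1
    have GαC : G (α ∪ Cq) = 2 * TS (α ∪ Cq) - TU (α ∪ Cq) := by
      refine G_of_both _ (fun h => ?_) (fun h => ?_)
      · rw [BαC] at h; exact hySUq h.2
      · rw [BαC] at h; exact hySUq h.2
    have Rα0 : R (α ∪ ∅) = Cα := by rw [Finset.union_empty]
    have two : 0 ≤ G (α ∪ ∅) + G (α ∪ Cq) := by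
      rw [Gα0, GαC]
      simp only [hTS, hTU, Pα0, PαV Cq subset_rfl hCq_ne, BαV ∅ (Finset.empty_subset _) (fun h => hCq_ne h.symm), BαC, Rα0]
      by_cases hqα : q ∈ Cα
      · have hR : R (α ∪ Cq) = insert y Cα := hpend1 α Cq hαAq subset_rfl hqα hCq_ne
        rw [hR]
        have key := skew_box_bound (fR := f Cα) (fA := f (insert y Cα)) (fB := f SUq) (fP := f SV) (gR := g Cα) (gA := g (insert y Cα)) (gB := g SUq) (gP := g SV)
          (hf (Set.subset_insert _ _)) (hf (hSV_univ _)) (hf hCαUq) (hg (Set.subset_insert _ _)) (hg (hSV_univ _)) (hg hCαUq)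
        nlinarith [key, mul_nonneg (sub_nonneg.mpr (hf hSUq_SV)) (sub_nonneg.mpr (hg hSUq_SV))]
      · have hR : R (α ∪ Cq) = Cα := hpend0 α Cq hαAq subset_rfl hqα
        rw [hR]
        nlinarith [mul_nonneg (sub_nonneg.mpr (hf hCαUq)) (sub_nonneg.mpr (hg hCαUq)), mul_nonneg (sub_nonneg.mpr (hf hCαUq)) (sub_nonneg.mpr (hg hSUq_SV)),
          mul_nonneg (sub_nonneg.mpr (hg hCαUq)) (sub_nonneg.mpr (hf hSUq_SV)), mul_nonneg (sub_nonneg.mpr (hf hSUq_SV)) (sub_nonneg.mpr (hg hSUq_SV))]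
    refine add_nonneg two (Finset.sum_nonneg fun γ hγ => ?_)
    obtain ⟨hγC, hγ0, hγ1⟩ := memC3 γ hγ
    have hB : B (α ∪ γ) = SV := BαV γ hγC hγ1
    have hP : P (α ∪ γ) = SV := PαV γ hγC hγ0
    rw [G_of_admS_only _ ⟨by rw [hP]; exact hyV, by rw [hB]; exact hyV⟩]
    refine mul_nonneg (by norm_num) (TS_nonneg_of_sub _ ?_)
    rw [hB]; exact hSV_univ _

end Coefficientwise

end Summit.CriticalPhenomena.PercolationContinuityZ3.Theorems
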